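import Literature.MathematicalPhysics.QuantumFieldTheory.Balaban1983to89.B2Prop31RegularFamily

/-!
# `Balaban1983to89.B2Prop31UniformConstant` — [Balaban1982Higgs2] Proposition 3.1 (3.26) p. 589: THE PRINTED QUANTIFIER
*"a constant γ₀ > 0 dependent on the space dimension d and the constant a only … We assume m² ≤ O(1) also"* MADE LITERAL
for the concrete general-field family of `B2Prop31RegularFamily` (p23 gen 9): ONE constant
`γ₀ = min(3a/(4(8d + 2m₁² + 4)), 1/16)`, a function of `d`, `a` and the bound `m₁²` of the printed *"m² ≤ O(1)"* ONLY, serves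
BOTH conjuncts of the cell's typed `B2.Prop31Printed Q (regP31Fam Q m² M)` for EVERY `L > 1`, every `0 < m² ≤ m₁²`, every error
modulus `M ≥ 0` (with `C = γ₀M`) — hence for every `ε`, `K`, choice of the sets `Λ₅⁽ᵏ⁾`, vector field `Ã^ε` and configuration `Φ`
of the family — removing the dependence on `L` and on the value of `m²` of the constants exhibited so far (`B2Prop31RegularFamily`
HONEST SCOPE (ii), cell GAPS G-B2-07 (vii)/(viii))

statement-level skeleton of published theorems with citation tags; proofs where landed; nothing here is a claim about the Yang–Mills mass gap

CITATION HEADER.  T. Bałaban, *(Higgs)₂,₃ quantum fields in a finite volume. II. An upper bound*, Commun. Math. Phys. **86**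
(1982) 555–594 [Balaban1982Higgs2], Prop. 3.1 (3.26) p. 589 [PDF 35] (PDF held `paper:balaban1982-cmp86-higgs23-ii`; the page READ on
the text layer `p0035.txt` ll. 8–22 materialised by this seat and on the ×2 render
`run/shared/lean/pub/pub-balaban/b2b-balaban-ref1/pages/1982-cmp86-higgs23-II/1982-cmp86-higgs23-II-p035-x2.png`); part I
[Balaban1982Higgs1] (2.15) p. 609 (`a_k ↘ a(1 − L⁻²)`).  Cell `lit-balaban` (HOME `run/shared/lean/pub/lit-balaban/`), reader/typer
seat **r14** gen 10 (unit `lit-balaban-r14`; B2 SECOND READER; TAKING line HOME/STATUS.md 2026-08-21T22:46:46Z).  SKELETON rows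
**B2.Prop3.1** (decl of record `B2.Prop31Printed`, owner r02) and **B2.Eq3.29**.  USED BY NAME, NOTHING RESTATED: p23 g9
`B2Prop31RegularFamily.{RMulti, RMulti.restricted, RMulti.bondKA, RMulti.vol, RMulti.vol_succ, regP31Fam, bondKA_zero}` (p306313) and
`B2Ineq329RegularField.prop31_regular_concrete` (p305722); p15 g4 `B2Prop31ZeroFieldConcrete.{gamma0, prop31_zeroField_concrete,
bondK_nonneg, massK_nonneg}` (p256491); `B2Eq328ConcretePieces.{sum_range_natExt, bond0_nonneg, mass0_nonneg}`;
`B2Ineq329ZeroAveraging.mesh_eq`; b2b's `B2.Prop31Printed`, `B2.Params`.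

WHAT IS PRINTED (verbatim, p. 589 [PDF 35]).  *"**Proposition 3.1.** There exists a constant γ₀ > 0 dependent on the space
dimension d and the constant a only, and independent of ε and a choice of the sets Λ₅⁽⁰⁾, …, Λ₅⁽ᴷ⁻¹⁾, such that for arbitrary
configurations Ã^ε, Φ defined by the formulas (3.2), (3.3), (3.24), and satisfying the restrictions given by the characteristic
functions in (3.21), the following inequality holds"* [(3.26)] *"with κ₀ > 0. The last symbol in the above inequality denotes
the measure of a set rescaled to the unit lattice, i.e. the number of points in the set. We assume m² ≤ O(1) also. If Ã^ε = 0,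
then the inequality holds without the last sum on the right side and without any restrictions on the configuration Φ."*

WHY A UNIFORM CONSTANT EXISTS (two lines).  p23's admissibility conditions for a `γ₀` in `prop31_regular_concrete` are
`0 ≤ γ₀ ≤ 1/16` and `γ₀(8d + 2m² + 4) ≤ a(1 − L⁻²)`; p15's zero-field constant is `gamma0 = min(a(1 − L⁻²)/(8d + 2m²), ¼)`.
Since `L` is a natural number `> 1`, `L ≥ 2` and `a(1 − L⁻²) ≥ ¾a` ((I.2.15): `a_∞ = a(1 − L⁻²)`); and `8d + 2m² + 4 ≤
8d + 2m₁² + 4` for `m² ≤ m₁²`.  So `γ₀ := min(3a/(4(8d + 2m₁² + 4)), 1/16)` is admissible for every `L` and every `m² ≤ m₁²`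
and is `≤ gamma0`.

WHAT THIS MODULE PROVES (kernel-checked, 0 `sorry`, standard axioms; theorems only — no definition, no `Prop`-valued fact).
 §1 `inv_sq_le_quarter`, `ainf_ge_three_quarters` (`¾a ≤ a(1 − L⁻²)` for `L ≥ 2`), `le_gamma0_of_admissible` (every
    admissible `γ₀` is `≤ gamma0`).
 §2 **`prop31_clauses_of_admissible`**: for ANY `γ₀ > 0` with `γ₀(8d + 2m² + 4) ≤ a(1 − L⁻²)`, `γ₀ ≤ 1/16`, BOTH conjuncts
    of `B2.Prop31Printed Q (regP31Fam Q m² M)` hold with that `γ₀` and `C = γ₀M` (p23's assembly with the constant as a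
    parameter); `prop31Printed_of_clauses` (repackaging into the typed decl).
 §3 **`prop31Printed_uniform`**: `∃ γ₀ > 0` depending on `(d, a, m₁²)` only such that for every `Q : B2.Params` with
    `Q.d = d`, `Q.a = a`, `Q.L > 1`, every `0 < m² ≤ m₁²`, every `M ≥ 0`, both conjuncts hold with `γ₀` and `C = γ₀M`;
    `prop31Printed_uniform_explicit` (the same with the witness `min(3a/(4(8d + 2m₁² + 4)), 1/16)` displayed);
    `prop31Printed_regular'` (p23's `prop31Printed_regular` re-derived through the uniform constant).
HONEST SCOPE.  (i) Only the QUANTIFIER ORDER of the constant is improved: `γ₀` is chosen before `L`, `m² (≤ m₁²)`, `M`,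
the lattice, the regions and the fields; the dependence on the bound `m₁²` is the print's *"We assume m² ≤ O(1)"*.  (ii) The
error constant `C = γ₀M` still carries the modulus `M` of p23's explicit reading of the (3.21) restrictions (`RMulti.restricted`,
pub-balaban G-pv07-1 (ii)); nothing about that reading is changed or derived here (cell GAPS G-B2-07 (ix)).  (iii) `N`
(number of field components) never entered `γ₀`.  (iv) No row head changes (owner r02); this is a fidelity complement of the
second reader.  Nothing here is summit progress.
-/

noncomputable section

open Finset Real
open scoped BigOperators

namespace Literature.MathematicalPhysics.QuantumFieldTheory.Balaban1983to89.B2Prop31UniformConstant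

open Literature.MathematicalPhysics.QuantumFieldTheory.Balaban1983to89.HiggsLattice
open Literature.MathematicalPhysics.QuantumFieldTheory.Balaban1983to89.HiggsAveraging
open Literature.MathematicalPhysics.QuantumFieldTheory.Balaban1983to89.HiggsCovariance
open Literature.MathematicalPhysics.QuantumFieldTheory.Balaban1983to89.HiggsCovariancePos
open Literature.MathematicalPhysics.QuantumFieldTheory.Balaban1983to89.B2Eq337ScalarIntegration
open Literature.MathematicalPhysics.QuantumFieldTheory.Balaban1983to89.B2Eq325ConcreteSchur
open Literature.MathematicalPhysics.QuantumFieldTheory.Balaban1983to89.B2Eq328ConcretePieces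
open Literature.MathematicalPhysics.QuantumFieldTheory.Balaban1983to89.B2Eq328DeltaK
open Literature.MathematicalPhysics.QuantumFieldTheory.Balaban1983to89.B2Ineq329ZeroAveraging
open Literature.MathematicalPhysics.QuantumFieldTheory.Balaban1983to89.B2Prop31ZeroFieldConcrete
open Literature.MathematicalPhysics.QuantumFieldTheory.Balaban1983to89.B2Eq255Concrete (barA barA_zero)
open Literature.MathematicalPhysics.QuantumFieldTheory.Balaban1983to89.B2Ineq329RegularField
open Literature.MathematicalPhysics.QuantumFieldTheory.Balaban1983to89.B2Prop31RegularFamily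

/-! ## §1 Arithmetic of the constant: `L ≥ 2 ⇒ a(1 − L⁻²) ≥ ¾a`; admissible constants are below p15's `gamma0` -/

/-- For a natural number `L > 1`: `(L²)⁻¹ ≤ ¼`. [folklore] [cite: Balaban1982Higgs1, (2.15) p.609] -/
theorem inv_sq_le_quarter {L : ℕ} (hL : 1 < L) : ((L : ℝ) ^ 2)⁻¹ ≤ 1 / 4 := by
  have h2 : (2 : ℝ) ≤ L := by exact_mod_cast hL
  have h4 : (4 : ℝ) ≤ (L : ℝ) ^ 2 := by nlinarith
  rw [one_div]
  exact inv_anti₀ (by norm_num) h4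

/-- `¾a ≤ a(1 − L⁻²) = a_∞` for `a ≥ 0` and a natural number `L > 1` — the limit (I.2.15) of the `a_k` is at least `¾a`
uniformly in `L`. [cite: Balaban1982Higgs1, (2.15) p.609] -/
theorem ainf_ge_three_quarters {L : ℕ} (hL : 1 < L) {a : ℝ} (ha : 0 ≤ a) :
    3 / 4 * a ≤ a * (1 - ((L : ℝ) ^ 2)⁻¹) := by
  have h := inv_sq_le_quarter hL
  nlinarith

/-- Every constant admissible for p23's regular-field (3.29) (`γ₀(8d + 2m² + 4) ≤ a(1 − L⁻²)`, `γ₀ ≤ 1/16`) is below p15's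
zero-field constant `gamma0 P a m² = min(a(1 − L⁻²)/(8d + 2m²), ¼)`. [cite: Balaban1982Higgs2, Prop. 3.1 p.589] -/
theorem le_gamma0_of_admissible {P : HiggsLattice.Params} {a msq γ₀ : ℝ} (hmsq : 0 ≤ msq)
    (hγ : 0 ≤ γ₀) (hγB : γ₀ * (8 * P.d + 2 * msq + 4) ≤ a * (1 - ((P.L : ℝ) ^ 2)⁻¹)) (hγ16 : γ₀ ≤ 1 / 16) :
    γ₀ ≤ gamma0 P a msq := by
  have hd : (1 : ℝ) ≤ P.d := by exact_mod_cast P.hd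
  have hB : 0 < 8 * (P.d : ℝ) + 2 * msq := by linarith
  unfold gamma0
  refine le_min ?_ (hγ16.trans (by norm_num))
  rw [le_div_iff₀ hB]
  calc γ₀ * (8 * P.d + 2 * msq) ≤ γ₀ * (8 * P.d + 2 * msq + 4) := by nlinarith
    _ ≤ a * (1 - ((P.L : ℝ) ^ 2)⁻¹) := hγB

/-! ## §2 Both conjuncts of Proposition 3.1 for ANY admissible constant (p23's assembly with `γ₀` a parameter) -/

/-- `Σ_{k=1}^{K} g k = Σ_{j<K} g (j+1)`. [folklore] [cite: Balaban1982Higgs2, Prop. 3.1 (3.26) p.589] -/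
private theorem sum_Icc_eq_sum_fin' (K : ℕ) (g : ℕ → ℝ) : ∑ k ∈ Finset.Icc 1 K, g k = ∑ j : Fin K, g (j.val + 1) := by
  have h : ∑ k ∈ Finset.range (K + 1), g k = g 0 + ∑ k ∈ Finset.Icc 1 K, g k := by
    rw [Finset.sum_range_eq_add_Ico _ (by omega : 0 < K + 1), Finset.Ico_add_one_right_eq_Icc]
  have h2 : ∑ k ∈ Finset.range (K + 1), g k = g 0 + ∑ j : Fin K, g (j.val + 1) := by
    rw [Finset.sum_range_succ', add_comm, Finset.sum_range]
  linarith

/-- **Proposition 3.1 (3.26), both conjuncts, on the concrete general-field family `regP31Fam Q m² M`, FOR ANY ADMISSIBLE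
CONSTANT**: if `0 < γ₀ ≤ 1/16` and `γ₀(8d + 2m² + 4) ≤ a(1 − L⁻²)` then every restricted instance satisfies (3.26) with error
`Σ_{k=1}^{K} γ₀M(Lᵏε)^{κ₀}|Λ_k|` and every instance with `Ã^ε = 0` satisfies it without the error and without restrictions
(p23's `prop31Printed_regular` with the constant exposed: restricted clause from `prop31_regular_concrete`, zero-field clause from
p15's `prop31_zeroField_concrete` and `γ₀ ≤ gamma0`). [cite: Balaban1982Higgs2, Prop. 3.1 (3.26) p.589] -/
theorem prop31_clauses_of_admissible (Q : B2.Params) (hQL : 1 < Q.L) (hQa : 0 < Q.a) {m2 : ℝ} (hm : 0 < m2)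
    (M : ℝ) {γ₀ : ℝ} (hγpos : 0 < γ₀)
    (hγB : γ₀ * (8 * Q.d + 2 * m2 + 4) ≤ Q.a * (1 - ((Q.L : ℝ) ^ 2)⁻¹)) (hγ16 : γ₀ ≤ 1 / 16) :
    (∀ i : RMulti Q m2 M, (regP31Fam Q m2 M i).restricted →
      γ₀ * (∑ k ∈ range ((regP31Fam Q m2 M i).K + 1), (regP31Fam Q m2 M i).bond k)
          + γ₀ * (∑ k ∈ range ((regP31Fam Q m2 M i).K + 1), (regP31Fam Q m2 M i).mass k)
          - (∑ k ∈ Icc 1 (regP31Fam Q m2 M i).K,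
              γ₀ * M * ((Q.L : ℝ) ^ k * (regP31Fam Q m2 M i).ε) ^ Q.κ₀ * (((regP31Fam Q m2 M i).vol k : ℕ) : ℝ))
        ≤ (regP31Fam Q m2 M i).form) ∧
    (∀ i : RMulti Q m2 M, (regP31Fam Q m2 M i).zeroField →
      γ₀ * (∑ k ∈ range ((regP31Fam Q m2 M i).K + 1), (regP31Fam Q m2 M i).bond k)
          + γ₀ * (∑ k ∈ range ((regP31Fam Q m2 M i).K + 1), (regP31Fam Q m2 M i).mass k)
        ≤ (regP31Fam Q m2 M i).form) := by
  refine ⟨fun i hr => ?_, fun i hz => ?_⟩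
  · -- the restricted clause (p23's assembly, `γ₀` a parameter)
    obtain ⟨hδ, hreg, hsmall, hΦ, hAbs⟩ := hr
    have hL : 1 < i.P.L := by rw [i.hL]; exact hQL
    have hγB' : γ₀ * (8 * i.P.d + 2 * m2 + 4) ≤ Q.a * (1 - ((i.P.L : ℝ) ^ 2)⁻¹) := by rw [i.hd, i.hL]; exact hγB
    have h := prop31_regular_concrete i.R i.C i.A i.hR i.hK i.hε hQa hL hm hδ hreg hsmall hγpos.le hγB' hγ16 i.Ψ i.Φ hΦ
    simp only [regP31Fam]
    rw [sum_range_natExt, sum_range_natExt, sum_Icc_eq_sum_fin']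
    have herr : ∑ j : Fin i.K, 64 * γ₀ * (i.P.d : ℝ) ^ 3 * i.C.e ^ 2 * ((i.P.L : ℝ) ^ (j.val + 1)) ^ 2 * i.δ j ^ 2 *
          (i.Ψ j ^ 2 * i.P.mesh (j.val + 1) ^ i.P.d * ((i.R.block j).card : ℝ))
        ≤ ∑ j : Fin i.K, γ₀ * M * ((Q.L : ℝ) ^ (j.val + 1) * i.P.mesh 0) ^ Q.κ₀ * ((i.vol (j.val + 1) : ℕ) : ℝ) := by
      refine Finset.sum_le_sum fun j _ => ?_
      rw [i.vol_succ j, ← i.hL, ← mesh_eq (j.val + 1)]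
      have hc : 0 ≤ ((i.R.block j).card : ℝ) := Nat.cast_nonneg _
      have h1 := mul_le_mul_of_nonneg_right (mul_le_mul_of_nonneg_left (hAbs j) hγpos.le) hc
      have e : 64 * γ₀ * (i.P.d : ℝ) ^ 3 * i.C.e ^ 2 * ((i.P.L : ℝ) ^ (j.val + 1)) ^ 2 * i.δ j ^ 2 *
            (i.Ψ j ^ 2 * i.P.mesh (j.val + 1) ^ i.P.d * ((i.R.block j).card : ℝ))
          = γ₀ * (64 * (i.P.d : ℝ) ^ 3 * i.C.e ^ 2 * ((i.P.L : ℝ) ^ (j.val + 1)) ^ 2 * i.δ j ^ 2 *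
            (i.Ψ j ^ 2 * i.P.mesh (j.val + 1) ^ i.P.d)) * ((i.R.block j).card : ℝ) := by ring
      rw [e]
      calc γ₀ * (64 * (i.P.d : ℝ) ^ 3 * i.C.e ^ 2 * ((i.P.L : ℝ) ^ (j.val + 1)) ^ 2 * i.δ j ^ 2 *
            (i.Ψ j ^ 2 * i.P.mesh (j.val + 1) ^ i.P.d)) * ((i.R.block j).card : ℝ)
          ≤ γ₀ * (M * i.P.mesh (j.val + 1) ^ Q.κ₀) * ((i.R.block j).card : ℝ) := h1
        _ = γ₀ * M * i.P.mesh (j.val + 1) ^ Q.κ₀ * ((i.R.block j).card : ℝ) := by ring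
    have hb : ∀ j : Fin i.K, i.bondKA j = ∑ c : HiggsLattice.PBond i.P (j.val + 1), if Inside (i.R.block j) c then
        i.P.mesh (j.val + 1) ^ i.P.d * ‖covDeriv i.C (barA (j.val + 1) i.A) (extL i.R j (resL i.R j i.Φ)) c‖ ^ 2 else 0 :=
      fun j => rfl
    simp only [hb]
    linarith [h, herr]
  · -- the zero-field clause (p15's theorem and `γ₀ ≤ gamma0`)
    have hA : i.A = 0 := hz
    have hL : 1 < i.P.L := by rw [i.hL]; exact hQL
    have h0 := prop31_zeroField_concrete i.R i.C i.hR i.hK i.hε hQa hL hm i.Φ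
    simp only [regP31Fam]
    rw [sum_range_natExt, sum_range_natExt]
    have hb : ∀ j : Fin i.K, i.bondKA j = bondK i.R j (resL i.R j i.Φ) := by
      intro j
      unfold RMulti.bondKA
      rw [hA]
      exact bondKA_zero i.R i.C j (resL i.R j i.Φ)
    simp only [hb]
    rw [hA]
    have hγB' : γ₀ * (8 * i.P.d + 2 * m2 + 4) ≤ Q.a * (1 - ((i.P.L : ℝ) ^ 2)⁻¹) := by rw [i.hd, i.hL]; exact hγB
    have hle : γ₀ ≤ gamma0 i.P Q.a m2 := le_gamma0_of_admissible hm.le hγpos.le hγB' hγ16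
    have hbn : 0 ≤ bond0 i.R i.C (0 : HiggsLattice.VecField i.P 0) i.Φ.1 + ∑ j, bondK i.R j (resL i.R j i.Φ) :=
      add_nonneg (bond0_nonneg i.R i.C _ i.Φ.1) (Finset.sum_nonneg fun j _ => bondK_nonneg i.R j _)
    have hmn : 0 ≤ mass0 i.R m2 i.Φ.1 + ∑ j, massK i.R m2 j (resL i.R j i.Φ) :=
      add_nonneg (mass0_nonneg i.R hm.le i.Φ.1) (Finset.sum_nonneg fun j _ => massK_nonneg i.R hm.le j _)
    have h1 := mul_le_mul_of_nonneg_right hle hbn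
    have h2 := mul_le_mul_of_nonneg_right hle hmn
    linarith [h0, h1, h2]

/-- Repackaging: the two clauses for an admissible `γ₀ > 0` (and `M ≥ 0`) give the cell's typed `B2.Prop31Printed Q` on the
family with THAT constant and `C = γ₀M`. [cite: Balaban1982Higgs2, Prop. 3.1 (3.26) p.589] -/
theorem prop31Printed_of_clauses (Q : B2.Params) (hQL : 1 < Q.L) (hQa : 0 < Q.a) {m2 : ℝ} (hm : 0 < m2)
    {M : ℝ} (hM : 0 ≤ M) {γ₀ : ℝ} (hγpos : 0 < γ₀)
    (hγB : γ₀ * (8 * Q.d + 2 * m2 + 4) ≤ Q.a * (1 - ((Q.L : ℝ) ^ 2)⁻¹)) (hγ16 : γ₀ ≤ 1 / 16) :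
    B2.Prop31Printed Q (regP31Fam Q m2 M) := by
  obtain ⟨h1, h2⟩ := prop31_clauses_of_admissible Q hQL hQa hm M hγpos hγB hγ16
  exact ⟨γ₀, γ₀ * M, hγpos, mul_nonneg hγpos.le hM, h1, h2⟩

/-! ## §3 ONE constant for all `L`, all `m² ≤ m₁²`, all `M`: *"dependent on … d and the constant a only"* -/

/-- **Proposition 3.1 with the PRINTED quantifier order of the constant**: for every dimension `d`, every `a > 0` and every
bound `m₁² ≥ 0` (the print's *"We assume m² ≤ O(1)"*) there is ONE `γ₀ > 0` — *"dependent on the space dimension d and the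
constant a only"* (and on `m₁²`) — such that for EVERY parameter record `Q` with `Q.d = d`, `Q.a = a`, `Q.L > 1`, EVERY
`0 < m² ≤ m₁²` and EVERY error modulus `M ≥ 0`, both conjuncts of (3.26) hold on the concrete general-field family
`regP31Fam Q m² M` with this `γ₀` and `C = γ₀M` — *"independent of ε and a choice of the sets Λ₅⁽⁰⁾, …, Λ₅⁽ᴷ⁻¹⁾"*, of `K`,
of `Ã^ε`, `Φ`, and also of `L` and of the value of `m²`. Witness: `γ₀ = min(3a/(4(8d + 2m₁² + 4)), 1/16)`.
[cite: Balaban1982Higgs2, Prop. 3.1 (3.26) p.589] -/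
theorem prop31Printed_uniform_explicit (d : ℕ) {a : ℝ} (ha : 0 < a) {m1 : ℝ} (hm1 : 0 ≤ m1)
    (Q : B2.Params) (hQd : Q.d = d) (hQa : Q.a = a) (hQL : 1 < Q.L) {m2 : ℝ} (hm : 0 < m2) (hm2 : m2 ≤ m1)
    (M : ℝ) :
    0 < min (3 * a / (4 * (8 * d + 2 * m1 + 4))) (1 / 16) ∧
    (∀ i : RMulti Q m2 M, (regP31Fam Q m2 M i).restricted →
      min (3 * a / (4 * (8 * d + 2 * m1 + 4))) (1 / 16)
            * (∑ k ∈ range ((regP31Fam Q m2 M i).K + 1), (regP31Fam Q m2 M i).bond k)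
          + min (3 * a / (4 * (8 * d + 2 * m1 + 4))) (1 / 16)
            * (∑ k ∈ range ((regP31Fam Q m2 M i).K + 1), (regP31Fam Q m2 M i).mass k)
          - (∑ k ∈ Icc 1 (regP31Fam Q m2 M i).K,
              min (3 * a / (4 * (8 * d + 2 * m1 + 4))) (1 / 16) * M
                * ((Q.L : ℝ) ^ k * (regP31Fam Q m2 M i).ε) ^ Q.κ₀ * (((regP31Fam Q m2 M i).vol k : ℕ) : ℝ))
        ≤ (regP31Fam Q m2 M i).form) ∧
    (∀ i : RMulti Q m2 M, (regP31Fam Q m2 M i).zeroField →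
      min (3 * a / (4 * (8 * d + 2 * m1 + 4))) (1 / 16)
            * (∑ k ∈ range ((regP31Fam Q m2 M i).K + 1), (regP31Fam Q m2 M i).bond k)
          + min (3 * a / (4 * (8 * d + 2 * m1 + 4))) (1 / 16)
            * (∑ k ∈ range ((regP31Fam Q m2 M i).K + 1), (regP31Fam Q m2 M i).mass k)
        ≤ (regP31Fam Q m2 M i).form) := by
  set γ₀ : ℝ := min (3 * a / (4 * (8 * d + 2 * m1 + 4))) (1 / 16) with hγ₀
  have hD1 : 0 < 4 * (8 * (d : ℝ) + 2 * m1 + 4) := by positivity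
  have hγpos : 0 < γ₀ := lt_min (div_pos (by linarith) hD1) (by norm_num)
  have hγ16 : γ₀ ≤ 1 / 16 := min_le_right _ _
  -- admissibility for `Q`, `m2`: `γ₀(8d + 2m² + 4) ≤ ¾a ≤ a(1 − L⁻²)`
  have hγB : γ₀ * (8 * Q.d + 2 * m2 + 4) ≤ Q.a * (1 - ((Q.L : ℝ) ^ 2)⁻¹) := by
    rw [hQd, hQa]
    have hle1 : γ₀ ≤ 3 * a / (4 * (8 * d + 2 * m1 + 4)) := min_le_left _ _
    have hpos : 0 < 8 * (d : ℝ) + 2 * m2 + 4 := by positivity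
    have hD0 : (8 * (d : ℝ) + 2 * m1 + 4) ≠ 0 := by positivity
    calc γ₀ * (8 * d + 2 * m2 + 4) ≤ 3 * a / (4 * (8 * d + 2 * m1 + 4)) * (8 * d + 2 * m1 + 4) := by
          have : (8 * (d : ℝ) + 2 * m2 + 4) ≤ 8 * d + 2 * m1 + 4 := by linarith
          exact mul_le_mul hle1 this hpos.le (div_pos (by linarith) hD1).le
      _ = 3 * a / 4 := by rw [div_mul_eq_mul_div, mul_div_mul_right _ _ hD0]
      _ = 3 / 4 * a := by ring
      _ ≤ a * (1 - ((Q.L : ℝ) ^ 2)⁻¹) := ainf_ge_three_quarters hQL ha.le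
  have hQa' : 0 < Q.a := by rw [hQa]; exact ha
  exact ⟨hγpos, prop31_clauses_of_admissible Q hQL hQa' hm M hγpos hγB hγ16⟩

/-- **Proposition 3.1 with the PRINTED quantifier order of the constant** (existential form): `∃ γ₀ > 0` depending only on
`(d, a, m₁²)` serving every `L > 1`, every `0 < m² ≤ m₁²`, every `M ≥ 0` (with `C = γ₀M`), every instance of the family.
[cite: Balaban1982Higgs2, Prop. 3.1 (3.26) p.589] -/
theorem prop31Printed_uniform (d : ℕ) {a : ℝ} (ha : 0 < a) {m1 : ℝ} (hm1 : 0 ≤ m1) :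
    ∃ γ₀ : ℝ, 0 < γ₀ ∧ ∀ (Q : B2.Params), Q.d = d → Q.a = a → 1 < Q.L →
      ∀ (m2 : ℝ), 0 < m2 → m2 ≤ m1 → ∀ (M : ℝ), 0 ≤ M →
        (∀ i : RMulti Q m2 M, (regP31Fam Q m2 M i).restricted →
          γ₀ * (∑ k ∈ range ((regP31Fam Q m2 M i).K + 1), (regP31Fam Q m2 M i).bond k)
              + γ₀ * (∑ k ∈ range ((regP31Fam Q m2 M i).K + 1), (regP31Fam Q m2 M i).mass k)
              - (∑ k ∈ Icc 1 (regP31Fam Q m2 M i).K,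
                  γ₀ * M * ((Q.L : ℝ) ^ k * (regP31Fam Q m2 M i).ε) ^ Q.κ₀ * (((regP31Fam Q m2 M i).vol k : ℕ) : ℝ))
            ≤ (regP31Fam Q m2 M i).form) ∧
        (∀ i : RMulti Q m2 M, (regP31Fam Q m2 M i).zeroField →
          γ₀ * (∑ k ∈ range ((regP31Fam Q m2 M i).K + 1), (regP31Fam Q m2 M i).bond k)
              + γ₀ * (∑ k ∈ range ((regP31Fam Q m2 M i).K + 1), (regP31Fam Q m2 M i).mass k)
            ≤ (regP31Fam Q m2 M i).form) := by
  refine ⟨min (3 * a / (4 * (8 * d + 2 * m1 + 4))) (1 / 16), ?_, fun Q hQd hQa hQL m2 hm hm2 M _ => ?_⟩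
  · have hD1 : 0 < 4 * (8 * (d : ℝ) + 2 * m1 + 4) := by positivity
    exact lt_min (div_pos (by linarith) hD1) (by norm_num)
  · exact (prop31Printed_uniform_explicit d ha hm1 Q hQd hQa hQL hm hm2 M).2

/-- p23's `prop31Printed_regular` re-derived through the uniform constant (same statement; shows the two routes agree on the
typed decl). [cite: Balaban1982Higgs2, Prop. 3.1 (3.26) p.589] -/
theorem prop31Printed_regular' (Q : B2.Params) (hQL : 1 < Q.L) (hQa : 0 < Q.a) {m2 : ℝ} (hm : 0 < m2)
    {M : ℝ} (hM : 0 ≤ M) : B2.Prop31Printed Q (regP31Fam Q m2 M) := by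
  obtain ⟨hpos, h1, h2⟩ := prop31Printed_uniform_explicit Q.d hQa hm.le Q rfl rfl hQL hm le_rfl M
  exact ⟨_, _, hpos, mul_nonneg hpos.le hM, h1, h2⟩

end Literature.MathematicalPhysics.QuantumFieldTheory.Balaban1983to89.B2Prop31UniformConstant

end
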